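import Summits.KontsevichZagierPeriods.KontsevichZagierPeriods.Theorems.HermiteRigidityReductionRigidityDupTowerNormalForm
import Summits.KontsevichZagierPeriods.KontsevichZagierPeriods.Theorems.HermiteRigidityReductionRigidityDupJoinValueNeg
import Literature.NumberTheory.DiophantineApproximation.PolylogShiftTowerLinearIndependence

/-!
# `ReductionRigidity` (stmt-KontsevichZagierPeriods-3407), line `Sketch`: the duplication tower of EVERY height is an
# island (`stub_dupTowerKernelGen`), UNCONDITIONALLY for `log N ≥ 4^{H+1}(w+1)³` (`stub_dupTowerKernelGenUnconditional`)

Route `KontsevichZagierPeriods/HermiteRigidity`, crux `ReductionRigidity` (stmt-3407, summit-equivalent; skeleton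
`Cruxes/ReductionRigidity/Lines/Sketch.lean` v7). Lead seat c7, growth item G15. On the box sector generated by all rescaled
box generators `[□ʲ, q x^a/(ν − ∏x)^m]` (`j ≤ w`, `q ∈ ℚ`) at the `2H + 1` levels `ν = N^{2^k}` (`k ≤ H`), `ν = −N^{2^k}`
(`k < H`) — the duplication tower of height `H` over `N ≥ 2` — Conjecture 1 of Kontsevich–Zagier holds in kernel form
(every `ℤ`-combination of value `0` is a chain of moves) as soon as the `(H+1)w + 1` numbers
`1, ∫_□ⁱ dp/(N − ∏p) (= Li_i(1/N)), ∫_□ⁱ dp/((−N^{2^k}) − ∏p) (= Li_i(−1/N^{2^k}))` (`1 ≤ i ≤ w`, `k < H`) are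
`ℚ`-linearly independent (`stub_dupTowerKernelGen`: the normal form `stub_dupTowerNormalForm` of the sibling file, the values
of the normal forms, and the vanishing of all surviving carriers); and that rigidity is a THEOREM of the tree for `H, w ≥ 1`
and `log N ≥ 4^{H+1}(w+1)³` (`Literature.NumberTheory.DiophantineApproximation.one_polylog_tower_linearIndependent`, the
`m = 2^H` case of the distinct-shifts theorem `one_lerchShift_linearIndependent` through the divisor bridge), whence
`stub_dupTowerKernelGenUnconditional` — an unconditional cross-level island on `2H + 1` levels for every `H`
(`H = 1`: `stub_dupJoinKernelGenUnconditional`, `H = 2`: `stub_dupTowerTwoKernelGenUnconditional`, up to constants).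

References: M. Kontsevich, D. Zagier, *Periods* (2001), §1.2 [cite: KontsevichZagier2001, §1.2]; S. David, N. Hirata-Kohno,
M. Kawashima, Moscow J. Comb. Number Theory 9 (2020), Thm 2.1 [cite: DavidHirataKohnoKawashima2020, Thm 2.1]. No definitions
are introduced.
-/

noncomputable section

open MeasureTheory Set MvPolynomial

namespace Summit.KontsevichZagierPeriods.HermiteRigidity.ReductionRigidity

open Literature.NumberTheory.Transcendental
open Literature.NumberTheory.Transcendental.KZ

/-- **Stub `stub_dupTowerKernelGen`** (sub-goal of crux `ReductionRigidity`, stmt-3407, line `Sketch`, lead c7, growth G15):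
**the duplication tower of height `H`, rigidity inlined.** For integers `H`, `w` and `N ≥ 2`: IF the `(H+1)w + 1` numbers
`1, ∫_□ⁱ dp/(N − ∏p), ∫_□ⁱ dp/((−N^{2^k}) − ∏p)` (`1 ≤ i ≤ w`, `k < H`) are `ℚ`-linearly independent, THEN Conjecture 1 of
Kontsevich–Zagier holds in kernel form on the sector generated by all rescaled box generators `[□ʲ, q x^a/(ν − ∏x)^m]`
(`j ≤ w`, `q ∈ ℚ`) at the levels `ν = N^{2^k}` (`k ≤ H`) and `ν = −N^{2^k}` (`k < H`): every `ℤ`-combination of value `0`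
lies in `KZ.relations`. [cite: KontsevichZagier2001, §1.2] [cite: DavidHirataKohnoKawashima2020, Thm 2.1] -/
theorem stub_dupTowerKernelGen : ∀ (H w N : ℕ), 2 ≤ N →
    (∀ (a : ℚ) (b : ℕ → ℚ) (c : ℕ → ℕ → ℚ),
      (a : ℝ) + ∑ i ∈ Finset.range w, (b i : ℝ) * (∫ p in cube (i + 1), 1 / ((N : ℝ) - ∏ l, p l)) +
          ∑ k ∈ Finset.range H, ∑ i ∈ Finset.range w,
            (c k i : ℝ) * (∫ p in cube (i + 1), 1 / ((-((N : ℝ) ^ (2 ^ k))) - ∏ l, p l)) = 0 →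
        a = 0 ∧ (∀ i ∈ Finset.range w, b i = 0) ∧ (∀ k ∈ Finset.range H, ∀ i ∈ Finset.range w, c k i = 0)) →
    ∀ c ∈ AddSubgroup.closure
      ({c | ∃ (k j : ℕ) (r : IntegralRep j) (q : ℚ) (a : Fin j → ℕ) (m : ℕ), k ≤ H ∧ j ≤ w ∧ r.domain = cube j ∧
          EqOn r.integrand (fun p => (q : ℝ) * (∏ l, p l ^ a l) / ((N : ℝ) ^ (2 ^ k) - ∏ l, p l) ^ m) (cube j) ∧
            c = KZ.of r} ∪
        {c | ∃ (k j : ℕ) (r : IntegralRep j) (q : ℚ) (a : Fin j → ℕ) (m : ℕ), k < H ∧ j ≤ w ∧ r.domain = cube j ∧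
          EqOn r.integrand (fun p => (q : ℝ) * (∏ l, p l ^ a l) / ((-((N : ℝ) ^ (2 ^ k))) - ∏ l, p l) ^ m) (cube j) ∧
            c = KZ.of r}),
      KZ.eval c = 0 → c ∈ KZ.relations := by
  intro H w N hN hrig c hc h0
  have cN : (((N : ℚ)) : ℝ) = (N : ℝ) := Rat.cast_natCast N
  have cNeg : ∀ k : ℕ, (((-((N : ℚ) ^ (2 ^ k))) : ℚ) : ℝ) = -((N : ℝ) ^ (2 ^ k)) := fun k => by push_cast; ring
  obtain ⟨α, β, s, t, hs, ht, hrel⟩ := stub_dupTowerNormalForm N w hN H c hc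
  -- VALUES of the normal forms
  set I : ℕ → ℝ → ℝ := fun i ν => ∫ p in cube i, 1 / (ν - ∏ l, p l) with hI
  have evs : ∀ i, KZ.eval (KZ.of (s i)) = (α i : ℝ) * I i N := fun i => by
    rw [eval_nfRep (ν := (N : ℚ)) (α := α i) (hs i).1 (fun p hp => by rw [(hs i).2 hp, cN]), cN]
  have evt : ∀ k i, KZ.eval (KZ.of (t k i)) = (β k i : ℝ) * I i (-((N : ℝ) ^ (2 ^ k))) := fun k i => by
    rw [eval_nfRep (ν := -((N : ℚ) ^ (2 ^ k))) (α := β k i) (ht k i).1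
      (fun p hp => by rw [(ht k i).2 hp, cNeg k]), cNeg k]
  have I0N : I 0 N = 1 / ((N : ℝ) - 1) := by
    have h := integral_cube_zero_level (N : ℚ)
    rw [cN] at h
    exact h
  have I0neg : ∀ k : ℕ, I 0 (-((N : ℝ) ^ (2 ^ k))) = 1 / (-((N : ℝ) ^ (2 ^ k)) - 1) := fun k => by
    have h := integral_cube_zero_level (-((N : ℚ) ^ (2 ^ k)))
    rw [cNeg k] at h
    exact h
  -- the value of `c`, in the shape of the rigidity hypothesis
  have e := eval_eq_zero_of_mem_relations hrel
  rw [map_sub, h0, zero_sub, neg_eq_zero, map_add, map_sum, map_sum] at e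
  simp only [map_sum, evs, evt] at e
  simp only [Finset.sum_range_succ', I0N, I0neg, Finset.sum_add_distrib] at e
  have h1 : ∑ k ∈ Finset.range H, (β k 0 : ℝ) * (1 / (-((N : ℝ) ^ (2 ^ k)) - 1)) =
      ∑ k ∈ Finset.range H, (β k 0 : ℝ) / (-((N : ℝ) ^ (2 ^ k)) - 1) :=
    Finset.sum_congr rfl fun k _ => by ring
  rw [h1] at e
  simp only [hI] at e
  have hval : (((α 0 / ((N : ℚ) - 1) + ∑ k ∈ Finset.range H, β k 0 / (-((N : ℚ) ^ (2 ^ k)) - 1) : ℚ)) : ℝ) +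
      ∑ i ∈ Finset.range w, (α (i + 1) : ℝ) * (∫ p in cube (i + 1), 1 / ((N : ℝ) - ∏ l, p l)) +
      ∑ k ∈ Finset.range H, ∑ i ∈ Finset.range w,
        (β k (i + 1) : ℝ) * (∫ p in cube (i + 1), 1 / ((-((N : ℝ) ^ (2 ^ k))) - ∏ l, p l)) = 0 := by
    push_cast
    linear_combination e
  obtain ⟨hA, hα, hβ⟩ := hrig _ (fun i => α (i + 1)) (fun k i => β k (i + 1)) hval
  -- RELATIONS: the surviving carriers of positive dimension vanish one by one
  have hS : ∀ i ∈ Finset.range w, KZ.of (s (i + 1)) ∈ KZ.relations := fun i hi =>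
    carrier_zero (D := cube (i + 1)) (fun b p => (b : ℝ) / ((N : ℝ) - ∏ l, p l)) (fun p => by simp) (hs (i + 1)).1
      (fun p hp => by rw [(hs (i + 1)).2 hp, show α (i + 1) = 0 from hα i hi])
  have hT : ∀ k ∈ Finset.range H, ∀ i ∈ Finset.range w, KZ.of (t k (i + 1)) ∈ KZ.relations := fun k hk i hi =>
    carrier_zero (D := cube (i + 1)) (fun b p => (b : ℝ) / ((-((N : ℝ) ^ (2 ^ k))) - ∏ l, p l)) (fun p => by simp)
      (ht k (i + 1)).1 (fun p hp => by rw [(ht k (i + 1)).2 hp, show β k (i + 1) = 0 from hβ k hk i hi])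
  -- dimension zero: `H + 1` constants summing to `0`
  have hZ : ∑ k ∈ Finset.range (H + 1), KZ.of (if k < H then t k 0 else s 0) ∈ KZ.relations := by
    refine sum_carriers_zero (D := cube 0) (fun b _ => (b : ℝ)) (fun b b' p => by push_cast; ring) (fun p => by simp)
      (fun b => exists_nf0 b) (fun k => if k < H then β k 0 / (-((N : ℚ) ^ (2 ^ k)) - 1) else α 0 / ((N : ℚ) - 1))
      (fun k => if k < H then t k 0 else s 0) (fun k => ?_) ?_
    · by_cases hk : k < H
      · simp only [hk, if_true]
        exact ⟨(ht k 0).1, fun p hp => by rw [(ht k 0).2 hp]; simp [Finset.univ_eq_empty]⟩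
      · simp only [hk, if_false]
        exact ⟨(hs 0).1, fun p hp => by rw [(hs 0).2 hp]; simp [Finset.univ_eq_empty]⟩
    · rw [Finset.sum_range_succ, if_neg (lt_irrefl H),
        Finset.sum_congr rfl fun k hk => if_pos (Finset.mem_range.1 hk)]
      linear_combination hA
  have hZ' : ∑ k ∈ Finset.range H, KZ.of (t k 0) + KZ.of (s 0) ∈ KZ.relations := by
    have e2 : ∑ k ∈ Finset.range H, KZ.of (if k < H then t k 0 else s 0) = ∑ k ∈ Finset.range H, KZ.of (t k 0) :=
      Finset.sum_congr rfl fun k hk => by rw [if_pos (Finset.mem_range.1 hk)]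
    rw [Finset.sum_range_succ, if_neg (lt_irrefl H), e2] at hZ
    exact hZ
  -- all together
  have hNF : ∑ i ∈ Finset.range (w + 1), KZ.of (s i) +
      ∑ k ∈ Finset.range H, ∑ i ∈ Finset.range (w + 1), KZ.of (t k i) =
      (∑ i ∈ Finset.range w, KZ.of (s (i + 1)) +
        ∑ k ∈ Finset.range H, ∑ i ∈ Finset.range w, KZ.of (t k (i + 1))) +
      (∑ k ∈ Finset.range H, KZ.of (t k 0) + KZ.of (s 0)) := by
    simp only [Finset.sum_range_succ', Finset.sum_add_distrib]
    abel
  have : c = (c - (∑ i ∈ Finset.range (w + 1), KZ.of (s i) +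
      ∑ k ∈ Finset.range H, ∑ i ∈ Finset.range (w + 1), KZ.of (t k i))) +
      (∑ i ∈ Finset.range (w + 1), KZ.of (s i) +
        ∑ k ∈ Finset.range H, ∑ i ∈ Finset.range (w + 1), KZ.of (t k i)) := by abel
  rw [this]
  refine KZ.relations.add_mem hrel ?_
  rw [hNF]
  exact KZ.relations.add_mem (KZ.relations.add_mem (KZ.relations.sum_mem hS)
    (KZ.relations.sum_mem fun k hk => KZ.relations.sum_mem fun i hi => hT k hk i hi)) hZ'

/-- **THE DUPLICATION TOWER OF HEIGHT `H`, UNCONDITIONAL FOR `log N ≥ 4^{H+1}(w+1)³`** (`H, w ≥ 1`): Conjecture 1 of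
Kontsevich–Zagier in kernel form on the sector generated by all rescaled box generators `[□ʲ, q x^a/(ν − ∏x)^m]` (`j ≤ w`,
`q ∈ ℚ`) at the `2H + 1` levels `ν = N^{2^k}` (`k ≤ H`), `ν = −N^{2^k}` (`k < H`) — every `ℤ`-combination of value `0` is a
chain of moves, with NO hypothesis. It is `stub_dupTowerKernelGen` fed with the PROVED rigidity
`one_polylog_tower_linearIndependent` (`1, Li_s(1/N), Li_s(−1/N^{2^k})`, `s ≤ w`, `k < H`, are `ℚ`-linearly independent for
`log N ≥ 4^{H+1}(w+1)³`), the normal-form values being the series by `stub_cubeIntegralSeriesLevel` and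
`integral_cube_one_div_prod_absLevel`. [cite: KontsevichZagier2001, §1.2] [cite: DavidHirataKohnoKawashima2020, Thm 2.1] -/
theorem stub_dupTowerKernelGenUnconditional : ∀ (H w N : ℕ), 1 ≤ H → 1 ≤ w →
    4 * 4 ^ H * ((w : ℝ) + 1) ^ 3 ≤ Real.log N →
    ∀ c ∈ AddSubgroup.closure
      ({c | ∃ (k j : ℕ) (r : IntegralRep j) (q : ℚ) (a : Fin j → ℕ) (m : ℕ), k ≤ H ∧ j ≤ w ∧ r.domain = cube j ∧
          EqOn r.integrand (fun p => (q : ℝ) * (∏ l, p l ^ a l) / ((N : ℝ) ^ (2 ^ k) - ∏ l, p l) ^ m) (cube j) ∧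
            c = KZ.of r} ∪
        {c | ∃ (k j : ℕ) (r : IntegralRep j) (q : ℚ) (a : Fin j → ℕ) (m : ℕ), k < H ∧ j ≤ w ∧ r.domain = cube j ∧
          EqOn r.integrand (fun p => (q : ℝ) * (∏ l, p l ^ a l) / ((-((N : ℝ) ^ (2 ^ k))) - ∏ l, p l) ^ m) (cube j) ∧
            c = KZ.of r}),
      KZ.eval c = 0 → c ∈ KZ.relations := by
  intro H w N hH hw hlog
  -- `N ≥ 2`
  have hw1 : (1 : ℝ) ≤ w := by exact_mod_cast hw
  have h4H : (4 : ℝ) ≤ 4 ^ H := by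
    calc (4 : ℝ) = 4 ^ 1 := by norm_num
      _ ≤ 4 ^ H := pow_le_pow_right₀ (by norm_num) hH
  have hL : (128 : ℝ) ≤ Real.log N := by
    have h2 : (8 : ℝ) ≤ ((w : ℝ) + 1) ^ 3 := by
      have := pow_le_pow_left₀ (by norm_num : (0 : ℝ) ≤ 2) (by linarith : (2 : ℝ) ≤ (w : ℝ) + 1) 3
      norm_num at this
      exact this
    have h3 : (4 : ℝ) * 4 * 8 ≤ 4 * 4 ^ H * ((w : ℝ) + 1) ^ 3 :=
      mul_le_mul (mul_le_mul_of_nonneg_left h4H (by norm_num)) h2 (by norm_num) (by positivity)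
    linarith
  have hN0 : (N : ℝ) ≠ 0 := by
    intro h0; rw [h0, Real.log_zero] at hL; linarith
  have hNpos : (0 : ℝ) < N := lt_of_le_of_ne (Nat.cast_nonneg N) (Ne.symm hN0)
  have hNR : (2 : ℝ) ≤ N := by
    have h1 : Real.log N ≤ (N : ℝ) - 1 := Real.log_le_sub_one_of_pos hNpos
    linarith
  have hN : 2 ≤ N := by exact_mod_cast hNR
  refine stub_dupTowerKernelGen H w N hN fun a b c h => ?_
  -- the values as series
  have IP : ∀ i, (∫ p in cube (i + 1), 1 / ((N : ℝ) - ∏ l, p l)) =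
      Literature.NumberTheory.DiophantineApproximation.DilogPade.polylogSeries (i + 1) (1 / (N : ℝ)) := fun i => by
    rw [stub_cubeIntegralSeriesLevel (i + 1) (N : ℝ) hNR,
      Literature.NumberTheory.DiophantineApproximation.DilogPade.polylogSeries]
  have IM : ∀ k i, (∫ p in cube (i + 1), 1 / ((-((N : ℝ) ^ (2 ^ k))) - ∏ l, p l)) =
      Literature.NumberTheory.DiophantineApproximation.DilogPade.polylogSeries (i + 1)
        (-(1 / (N : ℝ) ^ (2 ^ k))) := fun k i => by
    have hab : 1 < |(-((N : ℝ) ^ (2 ^ k)))| := by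
      rw [abs_neg, abs_of_nonneg (by positivity)]
      exact one_lt_pow₀ (by linarith) (pow_ne_zero k two_ne_zero)
    rw [integral_cube_one_div_prod_absLevel (i + 1) (-((N : ℝ) ^ (2 ^ k))) hab,
      Literature.NumberTheory.DiophantineApproximation.DilogPade.polylogSeries]
    refine tsum_congr fun n => ?_
    rw [one_div_neg_eq_neg_one_div]
  simp_rw [IP, IM] at h
  have key := Literature.NumberTheory.DiophantineApproximation.one_polylog_tower_linearIndependent H w hH hw N hlog a
    (fun j : Fin w => b j) (fun (j : Fin w) (k : Fin H) => c k j) (by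
      rw [Finset.sum_range (fun i => (b i : ℝ) *
          Literature.NumberTheory.DiophantineApproximation.DilogPade.polylogSeries (i + 1) (1 / (N : ℝ))),
        Finset.sum_comm,
        Finset.sum_range (fun i => ∑ k ∈ Finset.range H, (c k i : ℝ) *
          Literature.NumberTheory.DiophantineApproximation.DilogPade.polylogSeries (i + 1)
            (-(1 / (N : ℝ) ^ (2 ^ k))))] at h
      simp only [Finset.sum_range (fun k => (c k _ : ℝ) *
          Literature.NumberTheory.DiophantineApproximation.DilogPade.polylogSeries (_ + 1)
            (-(1 / (N : ℝ) ^ (2 ^ k))))] at h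
      exact h)
  obtain ⟨ha, hb, hc⟩ := key
  refine ⟨ha, fun i hi => ?_, fun k hk i hi => ?_⟩
  · have := congrFun hb ⟨i, Finset.mem_range.1 hi⟩
    simpa using this
  · have := congrFun (congrFun hc ⟨i, Finset.mem_range.1 hi⟩) ⟨k, Finset.mem_range.1 hk⟩
    simpa using this

end Summit.KontsevichZagierPeriods.HermiteRigidity.ReductionRigidity

end
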